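import Literature.MathematicalPhysics.QuantumLattice.TorusLimitParticleHole
import Literature.MathematicalPhysics.QuantumLattice.HubbardTTPrimeMeanEnergySupergradient
import Literature.MathematicalPhysics.QuantumLattice.InfVolFermionStateDensity
import HarnessLib

/-!
# The energy WORDS of `ω ∘ α` along torus limits: `K₁ ↦ K₁`, `K₂ ↦ -K₂`, `D ↦ D + 1 - ρ`,
# `e_{Φ(t,t',U)}(ω ∘ α) = e_{Φ(t,-t',U)}(ω) + U(1 - ρ(ω))` — vector AND mixture families, any `(t, t', U)`

Family `hubbard` (topic `MathematicalPhysics/QuantumLattice`); seat `hubbard-downfold-unc-2` (cell `pub/hubbard-downfold`, row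
«FILLING direction of BOX → WORD», electron-doped half). Sequel of `TorusLimitParticleHole` (`IsTorusLimitOf.particleHole`:
along eventually-even sides the particle–hole transform `ω ∘ α` of a torus limit of `N`-particle vectors `ψ_L` is the torus
limit of `P_Lᴴ ψ_L`). The two earlier dictionaries of the tree are CLASS-bound: `TorusSectorGibbsParticleHoleDictionary`
(canonical Gibbs class of `H(t,t',U)`, the identity for THAT `(t,t',U)`) and `TorusGroundStateParticleHole` (sector ground
states, via `energyDensityTT'_particleHole`). Here the identity is proved for EVERY torus limit of unit `N`-particle vectors
(resp. probability mixtures of such with a common particle number per side) and EVERY coupling triple, directly from the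
finite-volume conjugation `P H_L(t,t',U) Pᴴ = H_L(t,-t',U) - U N + U L²` (`particleHole_hubbardTorusTT'`):

* §1 finite volume: `Re⟨P_Lᴴψ, H_L(t,t',U) P_Lᴴψ⟩ = Re⟨ψ, H_L(t,-t',U) ψ⟩ - U N + U L²` for unit `N`-particle `ψ` (`L` even).
* §2 vector families (`ω.IsTorusLimitOf ψ Ls`, `ψ (Ls j)` unit `N_j`-particle, `Ls → ∞` eventually even):
  `N_j/(Ls j)² → ρ(ω)` (`IsTorusLimitOf.tendsto_natCast_div_sq`);
  **`e_{Φ(t,t',U)}(ω ∘ α) = e_{Φ(t,-t',U)}(ω) + U(1 - ρ(ω))`** (`IsTorusLimitOf.meanEnergy_particleHole_hubbardTTPrime`); the three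
  COORDINATE WORDS: nearest-neighbour kinetic `K₁(ω ∘ α) = K₁(ω)`, diagonal `K₂(ω ∘ α) = -K₂(ω)`, on-site
  `D(ω ∘ α) = D(ω) + 1 - ρ(ω)` (`…_kineticWord/_diagHopWord/_onSiteWord_particleHole`).
* §3 mixture families (`ω.IsTorusLimitOfMixture m p ψ Ls` with probability weights and unit `N_j`-particle components):
  `IsTorusLimitOfMixture.particleHole` (the transform is the mixture torus limit of the transformed components — for ANY such
  mixture, not only the canonical one of `TorusSectorGibbsParticleHole`), the same energy identity and coordinate words; the
  record thermal class (`sectorGibbs*`) as a corollary with `ρ = n`.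

USE: observable words of the phase-map cells are linear in `K₁, K₂, D` (kinetic-energy stiffness leaves, diagonal-hopping chords,
docc rows); through these identities a word certified for a class of `H(t, -t', U)` at density `2 - n` is read on the
particle–hole transforms of the electron-doped class at `(t, t', U, n)` coordinate by coordinate (with `TorusGroundStateParticleHole` /
`TorusSectorGibbsParticleHole` supplying the class membership of `ω ∘ α`). HONEST LIMITS: two dimensions, eventually-even sides;
no number. Everything is PROVED; no definition, no named fact, no sorry.

## References
* E. H. Lieb, F. Y. Wu, Physica A 321 (2003) 1, §1 eq. (3) (`E(M, M') = -(N_a - N)U + E(N_a - M, N_a - M')`). [cite: LiebWuPhysicaA2003, §1 eq. (3)]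
* F. H. L. Essler et al., *The One-Dimensional Hubbard Model* (2005), §2.2.4 eqs. (2.59)–(2.61). [cite: EsslerEtAl2005, §2.2.4 eqs. (2.59)–(2.61)]
* O. Bratteli, A. Kishimoto, D. W. Robinson, CMP 64 (1978) 41, §3 (mean energy of translation-invariant states). [cite: BratteliKishimotoRobinson1978, §3 (mean energy functional)]
* D. Ruelle, *Statistical Mechanics: Rigorous Results* (1969), §3.4 (densities of thermodynamic-limit states). [cite: Ruelle1969, §3.4]
* O. Bratteli, D. W. Robinson, *OAQSM I* (1987), §4.3.1. [cite: BratteliRobinsonI1987, §4.3.1 (PDF pp. 373–375)]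

## Mathlib / tree search
REUSED: `IsTorusLimitOf.particleHole`, `torusAvgExpect_phAut_eq` (`TorusLimitParticleHole`); `particleHole_hubbardTorusTT'`
(`HubbardNNNHoppingParticleHole`); `IsTorusLimitOf.tendsto_meanEnergy_hubbardTTPrime`, `meanEnergy_hubbardTTPrime_smul`
(`HubbardTTPrimeMeanEnergySupergradient`); `IsTorusLimitOfMixture(.tendsto_meanEnergy_hubbardTTPrime)` (`TorusLimitOfMixtures`);
`torusAvgExpect_nAt_add_nAt`, `InfVolFermionState.density/densityAt` (`InfVolFermionStateDensity`, `InfVolFermionState`);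
`density_particleHole`, `particleHole_expect` (`InfVolFermionStateParticleHole`); `isNParticle_sectorGibbsVectorTT'`,
`star_sectorGibbsVectorTT'_dotProduct_self`, `sum_sectorGibbsWeightTT'` (`TorusSectorGibbsMixture`); `totalNumber_mulVec_of_isNParticle`.
`lean search 'meanEnergy.*particleHole'`: only the two class-bound dictionaries named above.
-/

noncomputable section

namespace Literature.MathematicalPhysics.QuantumLattice

open Matrix Finset HubbardWave0 Literature.Probability.LatticeModels ThermodynamicLimit
open _root_.Filter
open scoped _root_.Topology ComplexOrder BigOperators

/-! ### §1 Finite volume: the energy of the transformed vector -/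

section Torus

variable {L : ℕ}

/-- The torus conjugation identity `P H_L(t, t', U) Pᴴ = H_L(t, -t', U) - U N + U L²` (`L` even), restated from
`particleHole_hubbardTorusTT'` in the instance context of this file. [cite: EsslerEtAl2005, §2.2.4 eqs. (2.59)–(2.61)] -/
private theorem particleHole_hubbardTorusTT'' (hL : Even L) (t t' U : ℝ) :
    particleHole (fun i : Orb (FermionTorus 2 L) => ((torusStagger (ofLex i).1 : ℤ) : ℂ)) *
        hubbardTorusTT' L t t' U *
        (particleHole (fun i : Orb (FermionTorus 2 L) => ((torusStagger (ofLex i).1 : ℤ) : ℂ)))ᴴ =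
      hubbardTorusTT' L t (-t') U - (U : ℂ) • totalNumber +
        ((U * L ^ 2 : ℝ) : ℂ) • (1 : Matrix (Finset (Orb (FermionTorus 2 L))) (Finset (Orb (FermionTorus 2 L))) ℂ) := by
  convert particleHole_hubbardTorusTT' hL t t' U using 4

/-- **The energy of the transformed vector** (`L` even, `ψ` a unit `N`-particle torus vector):
`Re⟨P_Lᴴψ, H_L(t,t',U) P_Lᴴψ⟩ = Re⟨ψ, H_L(t,-t',U) ψ⟩ - U N + U L²`. [cite: LiebWuPhysicaA2003, §1 eq. (3)] -/
theorem re_expect_hubbardTorusTT'_conjTranspose_particleHole_mulVec (hL : Even L) (t t' U : ℝ) {N : ℕ}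
    {ψ : Fock (Orb (FermionTorus 2 L))} (hN : IsNParticle N ψ) (h1 : star ψ ⬝ᵥ ψ = 1) :
    (QuantumLattice.expect (hubbardTorusTT' L t t' U)
        ((particleHole (fun i : Orb (FermionTorus 2 L) => ((torusStagger (ofLex i).1 : ℤ) : ℂ)))ᴴ *ᵥ ψ)).re =
      (QuantumLattice.expect (hubbardTorusTT' L t (-t') U) ψ).re - U * N + U * L ^ 2 := by
  have h : QuantumLattice.expect (hubbardTorusTT' L t t' U)
      ((particleHole (fun i : Orb (FermionTorus 2 L) => ((torusStagger (ofLex i).1 : ℤ) : ℂ)))ᴴ *ᵥ ψ) =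
      QuantumLattice.expect (hubbardTorusTT' L t (-t') U) ψ - (U : ℂ) * N + ((U * L ^ 2 : ℝ) : ℂ) := by
    unfold QuantumLattice.expect
    rw [star_mulVec, conjTranspose_conjTranspose, ← dotProduct_mulVec, mulVec_mulVec, mulVec_mulVec,
      particleHole_hubbardTorusTT'' hL t t' U, add_mulVec, sub_mulVec, smul_mulVec, smul_mulVec, one_mulVec,
      totalNumber_mulVec_of_isNParticle hN, dotProduct_add, dotProduct_sub, dotProduct_smul, dotProduct_smul,
      dotProduct_smul, h1]
    simp only [smul_eq_mul, mul_one]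
  rw [h]
  simp only [Complex.sub_re, Complex.add_re, Complex.ofReal_re, Complex.mul_re, Complex.ofReal_im, Complex.natCast_re,
    Complex.natCast_im, mul_zero, sub_zero]

end Torus

/-! ### §2 Vector families: the energy words of `ω ∘ α` for every torus limit of `N`-particle unit vectors -/

namespace InfVolFermionState

variable {ω : InfVolFermionState 2} {ψ : ∀ L, Fock (Orb (FermionTorus 2 L))} {Ls : ℕ → ℕ} {N : ℕ → ℕ}

/-- **The particle numbers per site converge to the density**: for a torus limit `ω` of unit `N_j`-particle vectors
along `Ls → ∞`, `N_j/(Ls j)² → ρ(ω)` (the averaged torus expectation of `n_{0↑} + n_{0↓}` IS `N_j/(Ls j)²`).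
[cite: Ruelle1969, §3.4] -/
theorem IsTorusLimitOf.tendsto_natCast_div_sq (h : ω.IsTorusLimitOf ψ Ls) (hLs : Tendsto Ls atTop atTop)
    (hN : ∀ j, IsNParticle (N j) (ψ (Ls j))) (h1 : ∀ j, star (ψ (Ls j)) ⬝ᵥ ψ (Ls j) = 1) :
    Tendsto (fun j => (N j : ℝ) / (Ls j : ℝ) ^ 2) atTop (𝓝 ω.density) := by
  have hlim := h ({0} : Finset (Site 2)) (nAt 0 (Finset.mem_singleton_self 0) 0 + nAt 0 (Finset.mem_singleton_self 0) 1)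
  have heq : ∀ᶠ j in atTop, torusAvgExpect (Ls j) ({0} : Finset (Site 2))
      (nAt 0 (Finset.mem_singleton_self 0) 0 + nAt 0 (Finset.mem_singleton_self 0) 1) (ψ (Ls j)) =
        (((N j : ℝ) / (Ls j : ℝ) ^ 2 : ℝ) : ℂ) := by
    filter_upwards [hLs.eventually_ge_atTop 1] with j hj
    haveI : NeZero (Ls j) := ⟨Nat.one_le_iff_ne_zero.1 hj⟩
    rw [torusAvgExpect_nAt_add_nAt (Ls j) (hN j) (h1 j)]
    push_cast
    rfl
  have hc := (Complex.continuous_re.tendsto _).comp (hlim.congr' heq)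
  have hre : (fun j => ((((N j : ℝ) / (Ls j : ℝ) ^ 2 : ℝ) : ℂ)).re) = fun j => (N j : ℝ) / (Ls j : ℝ) ^ 2 :=
    funext fun j => Complex.ofReal_re _
  rw [show ((Complex.re ∘ fun j => (((N j : ℝ) / (Ls j : ℝ) ^ 2 : ℝ) : ℂ))) =
    fun j => (N j : ℝ) / (Ls j : ℝ) ^ 2 from hre] at hc
  exact hc

/-- **THE ENERGY OF THE TRANSFORM, any couplings**: for every torus limit `ω` of unit `N_j`-particle vectors along
`Ls → ∞` with `Ls j` eventually even and all `t, t', U`,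
`e_{Φ(t,t',U)}(ω ∘ α) = e_{Φ(t,-t',U)}(ω) + U(1 - ρ(ω))` (finite volume `Re⟨Pᴴψ, H(t,t',U) Pᴴψ⟩/L² = Re⟨ψ, H(t,-t',U)ψ⟩/L²
- U N/L² + U`, then the three limits). [cite: LiebWuPhysicaA2003, §1 eq. (3)] [cite: BratteliKishimotoRobinson1978, §3 (mean energy functional)] -/
theorem IsTorusLimitOf.meanEnergy_particleHole_hubbardTTPrime (t t' U : ℝ) (h : ω.IsTorusLimitOf ψ Ls)
    (hLs : Tendsto Ls atTop atTop) (hN : ∀ j, IsNParticle (N j) (ψ (Ls j))) (h1 : ∀ j, star (ψ (Ls j)) ⬝ᵥ ψ (Ls j) = 1)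
    (heven : ∀ᶠ j in atTop, Even (Ls j)) :
    ω.particleHole.meanEnergy (hubbardTTPrimeFermionInteraction t t' U) 1 =
      ω.meanEnergy (hubbardTTPrimeFermionInteraction t (-t') U) 1 + U * (1 - ω.density) := by
  have hE' := (h.particleHole hN heven).tendsto_meanEnergy_hubbardTTPrime t t' U hLs
  have hE := h.tendsto_meanEnergy_hubbardTTPrime t (-t') U hLs
  have hρ := h.tendsto_natCast_div_sq hLs hN h1
  have hcomb : Tendsto (fun j => (star (ψ (Ls j)) ⬝ᵥ (hubbardTorusTT' (Ls j) t (-t') U *ᵥ ψ (Ls j))).re / (Ls j : ℝ) ^ 2 -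
      U * ((N j : ℝ) / (Ls j : ℝ) ^ 2) + U) atTop
      (𝓝 (ω.meanEnergy (hubbardTTPrimeFermionInteraction t (-t') U) 1 - U * ω.density + U)) :=
    (hE.sub (hρ.const_mul U)).add tendsto_const_nhds
  refine (tendsto_nhds_unique hE' (hcomb.congr' ?_)).trans (by ring)
  filter_upwards [hLs.eventually_ge_atTop 1, heven] with j hj hev
  have hL : ((Ls j : ℝ)) ^ 2 ≠ 0 := pow_ne_zero _ (Nat.cast_ne_zero.2 (by omega))
  have key := re_expect_hubbardTorusTT'_conjTranspose_particleHole_mulVec hev t t' U (hN j) (h1 j)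
  unfold QuantumLattice.expect at key
  rw [key]
  field_simp

/-- **The nearest-neighbour KINETIC word is particle–hole invariant**: `K₁(ω ∘ α) = K₁(ω)`,
`K₁ = e_{Φ(1,0,0)}` (sublattice-joining bonds: `c†_x c_y ↦ c†_y c_x`). [cite: EsslerEtAl2005, §2.2.4 eqs. (2.59)–(2.61)] -/
theorem IsTorusLimitOf.meanEnergy_kineticWord_particleHole (h : ω.IsTorusLimitOf ψ Ls) (hLs : Tendsto Ls atTop atTop)
    (hN : ∀ j, IsNParticle (N j) (ψ (Ls j))) (h1 : ∀ j, star (ψ (Ls j)) ⬝ᵥ ψ (Ls j) = 1)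
    (heven : ∀ᶠ j in atTop, Even (Ls j)) :
    ω.particleHole.meanEnergy (hubbardTTPrimeFermionInteraction 1 0 0) 1 =
      ω.meanEnergy (hubbardTTPrimeFermionInteraction 1 0 0) 1 := by
  have h0 := h.meanEnergy_particleHole_hubbardTTPrime 1 0 0 hLs hN h1 heven
  rwa [neg_zero, zero_mul, add_zero] at h0

/-- **The diagonal-hopping word changes sign**: `K₂(ω ∘ α) = -K₂(ω)`, `K₂ = e_{Φ(0,1,0)}` (same-sublattice bonds:
`c†_x c_y ↦ -c†_y c_x`; `t' ↦ -t'`). [cite: EsslerEtAl2005, §2.2.4 eqs. (2.59)–(2.61)] -/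
theorem IsTorusLimitOf.meanEnergy_diagHopWord_particleHole (h : ω.IsTorusLimitOf ψ Ls) (hLs : Tendsto Ls atTop atTop)
    (hN : ∀ j, IsNParticle (N j) (ψ (Ls j))) (h1 : ∀ j, star (ψ (Ls j)) ⬝ᵥ ψ (Ls j) = 1)
    (heven : ∀ᶠ j in atTop, Even (Ls j)) :
    ω.particleHole.meanEnergy (hubbardTTPrimeFermionInteraction 0 1 0) 1 =
      -ω.meanEnergy (hubbardTTPrimeFermionInteraction 0 1 0) 1 := by
  have h0 := h.meanEnergy_particleHole_hubbardTTPrime 0 1 0 hLs hN h1 heven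
  have hneg := ω.meanEnergy_hubbardTTPrime_smul (-1) 0 1 0
  rw [mul_zero, mul_one, neg_one_mul] at hneg
  rwa [zero_mul, add_zero, hneg] at h0

/-- **The on-site (double-occupancy) word**: `D(ω ∘ α) = D(ω) + 1 - ρ(ω)`, `D = e_{Φ(0,0,1)}` (the double occupancy of the
transform is the double VACANCY of `ω`). [cite: EsslerEtAl2005, §2.2.4 eqs. (2.59)–(2.61)] -/
theorem IsTorusLimitOf.meanEnergy_onSiteWord_particleHole (h : ω.IsTorusLimitOf ψ Ls) (hLs : Tendsto Ls atTop atTop)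
    (hN : ∀ j, IsNParticle (N j) (ψ (Ls j))) (h1 : ∀ j, star (ψ (Ls j)) ⬝ᵥ ψ (Ls j) = 1)
    (heven : ∀ᶠ j in atTop, Even (Ls j)) :
    ω.particleHole.meanEnergy (hubbardTTPrimeFermionInteraction 0 0 1) 1 =
      ω.meanEnergy (hubbardTTPrimeFermionInteraction 0 0 1) 1 + (1 - ω.density) := by
  have h0 := h.meanEnergy_particleHole_hubbardTTPrime 0 0 1 hLs hN h1 heven
  rwa [neg_zero, one_mul] at h0

end InfVolFermionState

/-! ### §3 Mixture families: the transform of a mixture torus limit and its energy words -/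

namespace InfVolFermionState

variable {ω : InfVolFermionState 2} {m : ℕ → ℕ} {p : ∀ L, Fin (m L) → ℝ}
  {ψ : ∀ L, Fin (m L) → Fock (Orb (FermionTorus 2 L))} {Ls : ℕ → ℕ}

/-- **The particle–hole transform of a MIXTURE torus limit of `N`-particle vectors is the mixture torus limit of the
transformed components** (eventually-even sides; any weights, any component-dependent particle numbers) — the general
form of `IsTorusLimitOfMixture.particleHole_of_sectorGibbs`. [cite: BratteliRobinsonI1987, §4.3.1 (PDF pp. 373–375)] -/
theorem IsTorusLimitOfMixture.particleHole (h : ω.IsTorusLimitOfMixture m p ψ Ls) {N : ∀ j, Fin (m (Ls j)) → ℕ}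
    (hN : ∀ j i, IsNParticle (N j i) (ψ (Ls j) i)) (heven : ∀ᶠ j in atTop, Even (Ls j)) :
    ω.particleHole.IsTorusLimitOfMixture m p
      (fun L i => (QuantumLattice.particleHole
        (fun o : Orb (FermionTorus 2 L) => ((torusStagger (ofLex o).1 : ℤ) : ℂ)))ᴴ *ᵥ ψ L i) Ls := by
  intro Λ A
  rw [particleHole_expect]
  refine (h Λ (phAut Λ A)).congr' ?_
  filter_upwards [heven] with j hev
  exact Finset.sum_congr rfl fun i _ => by rw [torusAvgExpect_phAut_eq hev Λ A (hN j i)]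

/-- **Densities of mixture torus limits**: if at side `Ls j` all components are unit `N_j`-particle vectors and the weights sum
to `1`, then `N_j/(Ls j)² → ρ(ω)`. [cite: Ruelle1969, §3.4] -/
theorem IsTorusLimitOfMixture.tendsto_natCast_div_sq (h : ω.IsTorusLimitOfMixture m p ψ Ls) (hLs : Tendsto Ls atTop atTop)
    {N : ℕ → ℕ} (hN : ∀ j i, IsNParticle (N j) (ψ (Ls j) i)) (h1 : ∀ j i, star (ψ (Ls j) i) ⬝ᵥ ψ (Ls j) i = 1)
    (hp : ∀ j, ∑ i, p (Ls j) i = 1) :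
    Tendsto (fun j => (N j : ℝ) / (Ls j : ℝ) ^ 2) atTop (𝓝 ω.density) := by
  have hlim := h ({0} : Finset (Site 2)) (nAt 0 (Finset.mem_singleton_self 0) 0 + nAt 0 (Finset.mem_singleton_self 0) 1)
  have heq : ∀ᶠ j in atTop, ∑ i, (p (Ls j) i : ℂ) * torusAvgExpect (Ls j) ({0} : Finset (Site 2))
      (nAt 0 (Finset.mem_singleton_self 0) 0 + nAt 0 (Finset.mem_singleton_self 0) 1) (ψ (Ls j) i) =
        (((N j : ℝ) / (Ls j : ℝ) ^ 2 : ℝ) : ℂ) := by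
    filter_upwards [hLs.eventually_ge_atTop 1] with j hj
    haveI : NeZero (Ls j) := ⟨Nat.one_le_iff_ne_zero.1 hj⟩
    simp_rw [fun i => torusAvgExpect_nAt_add_nAt (Ls j) (hN j i) (h1 j i)]
    rw [← Finset.sum_mul, ← Complex.ofReal_sum, hp j]
    push_cast
    rw [one_mul]
  have hc := (Complex.continuous_re.tendsto _).comp (hlim.congr' heq)
  have hre : (Complex.re ∘ fun j => (((N j : ℝ) / (Ls j : ℝ) ^ 2 : ℝ) : ℂ)) = fun j => (N j : ℝ) / (Ls j : ℝ) ^ 2 :=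
    funext fun j => Complex.ofReal_re _
  rw [hre] at hc
  exact hc

/-- **THE ENERGY OF THE TRANSFORM, mixtures, any couplings**: for every mixture torus limit `ω` along `Ls → ∞` eventually even,
with probability weights (`Σ_i p_i = 1`) and unit `N_j`-particle components, and all `t, t', U`:
`e_{Φ(t,t',U)}(ω ∘ α) = e_{Φ(t,-t',U)}(ω) + U(1 - ρ(ω))`. [cite: LiebWuPhysicaA2003, §1 eq. (3)]
[cite: BratteliKishimotoRobinson1978, §3 (mean energy functional)] -/
theorem IsTorusLimitOfMixture.meanEnergy_particleHole_hubbardTTPrime (t t' U : ℝ) (h : ω.IsTorusLimitOfMixture m p ψ Ls)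
    (hLs : Tendsto Ls atTop atTop) {N : ℕ → ℕ} (hN : ∀ j i, IsNParticle (N j) (ψ (Ls j) i))
    (h1 : ∀ j i, star (ψ (Ls j) i) ⬝ᵥ ψ (Ls j) i = 1) (hp : ∀ j, ∑ i, p (Ls j) i = 1)
    (heven : ∀ᶠ j in atTop, Even (Ls j)) :
    ω.particleHole.meanEnergy (hubbardTTPrimeFermionInteraction t t' U) 1 =
      ω.meanEnergy (hubbardTTPrimeFermionInteraction t (-t') U) 1 + U * (1 - ω.density) := by
  have hE' := (h.particleHole (N := fun j _ => N j) hN heven).tendsto_meanEnergy_hubbardTTPrime t t' U hLs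
  have hE := h.tendsto_meanEnergy_hubbardTTPrime t (-t') U hLs
  have hρ := h.tendsto_natCast_div_sq hLs hN h1 hp
  have hcomb : Tendsto (fun j => ∑ i, p (Ls j) i *
      ((QuantumLattice.expect (hubbardTorusTT' (Ls j) t (-t') U) (ψ (Ls j) i)).re / (Ls j : ℝ) ^ 2) -
      U * ((N j : ℝ) / (Ls j : ℝ) ^ 2) + U) atTop
      (𝓝 (ω.meanEnergy (hubbardTTPrimeFermionInteraction t (-t') U) 1 - U * ω.density + U)) :=
    (hE.sub (hρ.const_mul U)).add tendsto_const_nhds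
  refine (tendsto_nhds_unique hE' (hcomb.congr' ?_)).trans (by ring)
  filter_upwards [hLs.eventually_ge_atTop 1, heven] with j hj hev
  have hL : ((Ls j : ℝ)) ^ 2 ≠ 0 := pow_ne_zero _ (Nat.cast_ne_zero.2 (by omega))
  have key : ∀ i, (QuantumLattice.expect (hubbardTorusTT' (Ls j) t t' U)
      ((QuantumLattice.particleHole (fun o : Orb (FermionTorus 2 (Ls j)) => ((torusStagger (ofLex o).1 : ℤ) : ℂ)))ᴴ *ᵥ
        ψ (Ls j) i)).re / (Ls j : ℝ) ^ 2 =
      (QuantumLattice.expect (hubbardTorusTT' (Ls j) t (-t') U) (ψ (Ls j) i)).re / (Ls j : ℝ) ^ 2 -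
        U * ((N j : ℝ) / (Ls j : ℝ) ^ 2) + U := fun i => by
    rw [re_expect_hubbardTorusTT'_conjTranspose_particleHole_mulVec hev t t' U (hN j i) (h1 j i)]
    field_simp
  simp_rw [key, mul_add, mul_sub, Finset.sum_add_distrib, Finset.sum_sub_distrib, ← Finset.sum_mul, hp j, one_mul]

/-- `K₁(ω ∘ α) = K₁(ω)` for mixture torus limits. [cite: EsslerEtAl2005, §2.2.4 eqs. (2.59)–(2.61)] -/
theorem IsTorusLimitOfMixture.meanEnergy_kineticWord_particleHole (h : ω.IsTorusLimitOfMixture m p ψ Ls)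
    (hLs : Tendsto Ls atTop atTop) {N : ℕ → ℕ} (hN : ∀ j i, IsNParticle (N j) (ψ (Ls j) i))
    (h1 : ∀ j i, star (ψ (Ls j) i) ⬝ᵥ ψ (Ls j) i = 1) (hp : ∀ j, ∑ i, p (Ls j) i = 1)
    (heven : ∀ᶠ j in atTop, Even (Ls j)) :
    ω.particleHole.meanEnergy (hubbardTTPrimeFermionInteraction 1 0 0) 1 =
      ω.meanEnergy (hubbardTTPrimeFermionInteraction 1 0 0) 1 := by
  have h0 := h.meanEnergy_particleHole_hubbardTTPrime 1 0 0 hLs hN h1 hp heven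
  rwa [neg_zero, zero_mul, add_zero] at h0

/-- `K₂(ω ∘ α) = -K₂(ω)` for mixture torus limits. [cite: EsslerEtAl2005, §2.2.4 eqs. (2.59)–(2.61)] -/
theorem IsTorusLimitOfMixture.meanEnergy_diagHopWord_particleHole (h : ω.IsTorusLimitOfMixture m p ψ Ls)
    (hLs : Tendsto Ls atTop atTop) {N : ℕ → ℕ} (hN : ∀ j i, IsNParticle (N j) (ψ (Ls j) i))
    (h1 : ∀ j i, star (ψ (Ls j) i) ⬝ᵥ ψ (Ls j) i = 1) (hp : ∀ j, ∑ i, p (Ls j) i = 1)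
    (heven : ∀ᶠ j in atTop, Even (Ls j)) :
    ω.particleHole.meanEnergy (hubbardTTPrimeFermionInteraction 0 1 0) 1 =
      -ω.meanEnergy (hubbardTTPrimeFermionInteraction 0 1 0) 1 := by
  have h0 := h.meanEnergy_particleHole_hubbardTTPrime 0 1 0 hLs hN h1 hp heven
  have hneg := ω.meanEnergy_hubbardTTPrime_smul (-1) 0 1 0
  rw [mul_zero, mul_one, neg_one_mul] at hneg
  rwa [zero_mul, add_zero, hneg] at h0

/-- `D(ω ∘ α) = D(ω) + 1 - ρ(ω)` for mixture torus limits. [cite: EsslerEtAl2005, §2.2.4 eqs. (2.59)–(2.61)] -/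
theorem IsTorusLimitOfMixture.meanEnergy_onSiteWord_particleHole (h : ω.IsTorusLimitOfMixture m p ψ Ls)
    (hLs : Tendsto Ls atTop atTop) {N : ℕ → ℕ} (hN : ∀ j i, IsNParticle (N j) (ψ (Ls j) i))
    (h1 : ∀ j i, star (ψ (Ls j) i) ⬝ᵥ ψ (Ls j) i = 1) (hp : ∀ j, ∑ i, p (Ls j) i = 1)
    (heven : ∀ᶠ j in atTop, Even (Ls j)) :
    ω.particleHole.meanEnergy (hubbardTTPrimeFermionInteraction 0 0 1) 1 =
      ω.meanEnergy (hubbardTTPrimeFermionInteraction 0 0 1) 1 + (1 - ω.density) := by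
  have h0 := h.meanEnergy_particleHole_hubbardTTPrime 0 0 1 hLs hN h1 hp heven
  rwa [neg_zero, one_mul] at h0

/-- **The record thermal class** (canonical sector Gibbs torus limits of `H(t₀, t'₀, U₀)` at density `0 ≤ n ≤ 2`, inverse
temperature `β`, eventually-even `Ls → ∞`): for ALL `t, t', U`,
`e_{Φ(t,t',U)}(ω ∘ α) = e_{Φ(t,-t',U)}(ω) + U(1 - n)` — in particular `K₁(ω ∘ α) = K₁(ω)`, `K₂(ω ∘ α) = -K₂(ω)`,
`D(ω ∘ α) = D(ω) + 1 - n`. [cite: LiebWuPhysicaA2003, §1 eq. (3)] -/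
theorem IsTorusLimitOfMixture.meanEnergy_particleHole_hubbardTTPrime_of_sectorGibbs (β t₀ t'₀ U₀ : ℝ) {n : ℝ}
    (hn0 : 0 ≤ n) (hn2 : n ≤ 2) {ω : InfVolFermionState 2} {Ls : ℕ → ℕ}
    (h : ω.IsTorusLimitOfMixture (sectorGibbsCount n) (fun L => sectorGibbsWeightTT' β t₀ t'₀ U₀ n L)
      (fun L => sectorGibbsVectorTT' t₀ t'₀ U₀ n L) Ls)
    (hLs : Tendsto Ls atTop atTop) (heven : ∀ᶠ j in atTop, Even (Ls j)) (t t' U : ℝ) :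
    ω.particleHole.meanEnergy (hubbardTTPrimeFermionInteraction t t' U) 1 =
      ω.meanEnergy (hubbardTTPrimeFermionInteraction t (-t') U) 1 + U * (1 - n) := by
  rw [← h.density_eq_of_sectorGibbs t₀ t'₀ U₀ hn0 hn2 β hLs]
  exact h.meanEnergy_particleHole_hubbardTTPrime t t' U hLs (N := fun j => rectN n (Ls j))
    (fun j i => isNParticle_sectorGibbsVectorTT' t₀ t'₀ U₀ n (Ls j) i)
    (fun j i => star_sectorGibbsVectorTT'_dotProduct_self t₀ t'₀ U₀ n (Ls j) i)
    (fun j => sum_sectorGibbsWeightTT' β t₀ t'₀ U₀ hn0 hn2 (Ls j)) heven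

/-- **The record `T = 0` class** (torus limits of unit `(rectN n L, S^z = 0)`-sector ground states of `H_L(t₀, t'₀, U₀)`,
`n ≥ 0`, eventually-even `Ls → ∞`): for ALL `t, t', U`, `e_{Φ(t,t',U)}(ω ∘ α) = e_{Φ(t,-t',U)}(ω) + U(1 - n)` — in particular
the coordinate words `K₁ ↦ K₁`, `K₂ ↦ -K₂`, `D ↦ D + 1 - n` (no complementarity of sectors needed for these identities).
[cite: LiebWuPhysicaA2003, §1 eq. (3)] -/
theorem IsTorusLimitOf.meanEnergy_particleHole_hubbardTTPrime_of_sectorGroundStates (t₀ t'₀ U₀ : ℝ) {n : ℝ} (hn0 : 0 ≤ n)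
    {ω : InfVolFermionState 2} {Ls : ℕ → ℕ} {ψ : ∀ L, Fock (Orb (FermionTorus 2 L))}
    (h : ω.IsTorusLimitOf ψ Ls) (hLs : Tendsto Ls atTop atTop)
    (hψ : ∀ j, IsGroundStateInSector (hubbardTorusTT' (Ls j) t₀ t'₀ U₀) (rectN n (Ls j)) 0 (ψ (Ls j)))
    (h1 : ∀ j, star (ψ (Ls j)) ⬝ᵥ ψ (Ls j) = 1) (heven : ∀ᶠ j in atTop, Even (Ls j)) (t t' U : ℝ) :
    ω.particleHole.meanEnergy (hubbardTTPrimeFermionInteraction t t' U) 1 =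
      ω.meanEnergy (hubbardTTPrimeFermionInteraction t (-t') U) 1 + U * (1 - n) := by
  have hN : ∀ j, IsNParticle (rectN n (Ls j)) (ψ (Ls j)) := fun j => ((mem_szSector_iff _ _ _).1 (hψ j).1).1
  rw [← h.density_eq_of_rectN hLs hn0 hN h1]
  exact h.meanEnergy_particleHole_hubbardTTPrime t t' U hLs hN h1 heven

end InfVolFermionState

end Literature.MathematicalPhysics.QuantumLattice
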